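import Summits.ValiantsHypothesis.ValiantsHypothesis.Theorems.BarrierLeverChowBenchmarkPairsDualisation

/-!
# Route BarrierLever — item 22038 `ChowBenchmarkPairs`, line `moore-peel`: 0/1 POINT TABLES —
# the closed form of the segment moments, the Beta identity, and the typed node `stub_zeroOneDesign`

Helper file (`--supports stmt-ValiantsHypothesis-22038`; cell valiant-natproofs, rung V4, 𝒟-side
benchmark of record; seat val-np-p4 gen 19; line `Cruxes/ChowBenchmarkPairs/Lines/moore_peel.lean`,
registered stubs `stub_segmentMeanValue`, `stub_s10`).  Closes NO item.

The line's open content is `∀ h, SegmentMeanValueAt h`: SOME point table `P : Fin h → Fin h → ℂ` makes the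
segment-moment matrix `[segEntry P (u i) T_j]` (rows = all `S ⊆ Fin h` with `|S| ≤ 2`, columns = the first
`r_h = 1 + h + C(h,2)` binary codes) nonsingular, where
`segEntry P S T = Σ_{g : T → S} ∏_{c∈T} P_{g(c),c} · ∏_{a∈S} |g⁻¹(a)|!`.

THIS FILE isolates the sub-family of **0/1 point tables** `P = zoTable σ` (`P a c = [c ∈ σ a]` for a support
family `σ : Fin h → Finset (Fin h)`), in which everything is a small integer:

* `segSum_pair_zoTable` — for `a ≠ b` the pair entry is
  `[T ⊆ σ a ∪ σ b] · betaSum p q m`, `betaSum p q m = Σ_{i ≤ m} C(m,i) (p+i)! (q+m-i)!`,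
  with `p = |T ∖ σ b|` (coordinates forced to `a`), `q = |T ∖ σ a|`, `m = |T ∩ σ a ∩ σ b|` (free);
  the proof is the re-indexing `d = (T ∖ σ b) ⊔ E`, `E ⊆ T ∩ σ a ∩ σ b`, of the subset sum `segSum_pair`.
* `betaSum_mul_factorial` — the Beta identity `betaSum p q m · (p+q+1)! = p! · q! · (p+q+m+1)!`
  (Chu–Vandermonde for rising factorials; induction on `m` via `Finset.sum_choose_succ_mul`).  Hence after
  dividing column `T` by `(|T|+1)!` the 0/1 segment-moment matrix has the entries
  `[T ⊆ σ a ∪ σ b] · p! q! / (p+q+1)!` = `∫₀¹ t^p (1-t)^q dt` (`segSum_pair_zoTable_mul`): the matrix of SEGMENT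
  MEANS of the monomials `z^T` over the segments `[𝟙_{σ a}, 𝟙_{σ b}]` of the unit cube (the functional
  `g ↦ ⨍ g` over an axis box's diagonal is a Beta-weighted average of the box's corner values).
* `Stmt.stub_zeroOneDesign` — CONJECTURE Z01 (val-np-p4 g19): for every `h` some 0/1 table works; and the
  ∃-introduction `segmentMeanValue_of_zeroOneDesign : stub_zeroOneDesign → ∀ h, SegmentMeanValueAt h`
  (the line file's statement, unfolded verbatim as in `…Dualisation.stub_dualisation`).

EVIDENCE for Z01 (numerics of the seat, HOME/val-np-p4/g19/): exhaustive h = 4 (200 of 1 365 support families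
nonsingular), h = 5 (163 of 3 003); random families / hill-climbing give a nonsingular 0/1 design for EVERY
h ≤ 32 tested, found within seconds (kit j306146); the S10 supports with all scalars = 1 are NOT enough
(deficit 1–10 for 5 ≤ h ≤ 30), i.e. the support pattern matters.  NEGATIVE structure results (memo
MEMO-zero-one-designs-valnp4-g19.md): purely TRIANGULAR combinatorial certificates (a bijection rows → columns
with supports nested along an order, in the monomial, cylinder `z^J∏_{c∈J'}(1-z_c)` or box-vertex bases) exist
only sporadically (h = 3, 5; none at h = 4, 6, 7 by exhaustive search / SAT); product designs and
𝔽₂-linear or affine support families are provably singular.  So Z01 is a statement about small-block or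
global structure, not about triangularity.

WHAT THIS IS NOT: no stub of the line is closed; `stub_zeroOneDesign` is a typed CONJECTURE (a candidate node,
not registered here); nothing on items 20172 / 19717, crux stmt-ValiantsHypothesis-14610, or `VP` versus `VNP`.
-/

set_option linter.dupNamespace false

namespace Summit.ValiantsHypothesis.ValiantsHypothesis.Theorems.BarrierLever.ChowBenchmarkZeroOne

open Finset
open Summit.ValiantsHypothesis.ValiantsHypothesis.Theorems.BarrierLever.MoorePeel (benchCols)
open Summit.ValiantsHypothesis.ValiantsHypothesis.Theorems.BarrierLever.ChowBenchmarkDual (segSum_pair)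

variable {h : ℕ}

/-! ## 1. The Beta identity `Σ_i C(m,i) (p+i)! (q+m-i)! · (p+q+1)! = p! q! (p+q+m+1)!` -/

/-- `betaSum p q m = Σ_{i=0}^{m} C(m,i) · (p+i)! · (q+(m-i))!` — the pair entry of the 0/1 segment-moment
matrix at a column with `p` coordinates forced to the first point, `q` forced to the second and `m` free. -/
def betaSum (p q m : ℕ) : ℕ :=
  ∑ i ∈ range (m + 1), m.choose i * ((p + i).factorial * (q + (m - i)).factorial)

/-- `betaSum p q 0 = p! q!`. -/
@[simp] theorem betaSum_zero (p q : ℕ) : betaSum p q 0 = p.factorial * q.factorial := by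
  simp [betaSum]

/-- Pascal: `betaSum p q (m+1) = betaSum p (q+1) m + betaSum (p+1) q m`. -/
theorem betaSum_succ (p q m : ℕ) :
    betaSum p q (m + 1) = betaSum p (q + 1) m + betaSum (p + 1) q m := by
  unfold betaSum
  have key := Finset.sum_choose_succ_mul
    (fun i j : ℕ => ((p + i).factorial * (q + j).factorial : ℕ)) m
  -- `key : Σ_{i<m+2} C(m+1,i) f i (m+1-i) = Σ_{i<m+1} C(m,i) f i (m+1-i) + Σ_{i<m+1} C(m,i) f (i+1) (m-i)`
  simp only [Nat.cast_id] at key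
  rw [key]
  congr 1
  · refine Finset.sum_congr rfl fun i hi => ?_
    have hi' : i ≤ m := Nat.lt_succ_iff.mp (Finset.mem_range.mp hi)
    rw [Nat.succ_sub hi', Nat.add_succ, Nat.succ_add]
  · refine Finset.sum_congr rfl fun i _ => ?_
    rw [show p + 1 + i = p + (i + 1) by omega]

/-- **The Beta identity** `betaSum p q m · (p+q+1)! = p! · q! · (p+q+m+1)!`
(equivalently `Σ_i C(m,i) B(p+i+1, q+m-i+1) = B(p+1, q+1)`, or the rising-factorial binomial theorem
`(x+y)^{(m)} = Σ_i C(m,i) x^{(i)} y^{(m-i)}` at `x = p+1`, `y = q+1`). -/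
theorem betaSum_mul_factorial (p q m : ℕ) :
    betaSum p q m * (p + q + 1).factorial = p.factorial * q.factorial * (p + q + m + 1).factorial := by
  induction m generalizing p q with
  | zero => simp
  | succ m ih =>
    have h1 := ih p (q + 1)
    have h2 := ih (p + 1) q
    -- multiply the goal by `p+q+2` and use the two instances of the induction hypothesis
    have hne : p + q + 2 ≠ 0 := by omega
    apply Nat.eq_of_mul_eq_mul_right (Nat.pos_of_ne_zero hne)
    have e1 : p + (q + 1) + 1 = p + q + 2 := by omega
    have e2 : p + 1 + q + 1 = p + q + 2 := by omega
    have e3 : p + (q + 1) + m + 1 = p + q + m + 2 := by omega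
    have e4 : p + 1 + q + m + 1 = p + q + m + 2 := by omega
    rw [e1, e3] at h1
    rw [e2, e4] at h2
    have hf : (p + q + 2).factorial = (p + q + 2) * (p + q + 1).factorial := Nat.factorial_succ _
    calc betaSum p q (m + 1) * (p + q + 1).factorial * (p + q + 2)
        = (betaSum p (q + 1) m + betaSum (p + 1) q m) * (p + q + 2).factorial := by
          rw [betaSum_succ, hf]; ring
      _ = p.factorial * (q + 1).factorial * (p + q + m + 2).factorial
            + (p + 1).factorial * q.factorial * (p + q + m + 2).factorial := by
          rw [add_mul, h1, h2]
      _ = p.factorial * q.factorial * (p + q + (m + 1) + 1).factorial * (p + q + 2) := by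
          rw [Nat.factorial_succ q, Nat.factorial_succ p, show p + q + (m + 1) + 1 = p + q + m + 2 by omega]
          ring

/-! ## 2. 0/1 point tables and the closed form of the pair entry -/

/-- The 0/1 point table of a support family: `P a c = [c ∈ σ a]`. -/
def zoTable (σ : Fin h → Finset (Fin h)) : Fin h → Fin h → ℂ :=
  fun a c => if c ∈ σ a then 1 else 0

/-- A monomial of a 0/1 row: `∏_{c ∈ d} [c ∈ σ a] = [d ⊆ σ a]`. -/
theorem prod_zoTable (σ : Fin h → Finset (Fin h)) (a : Fin h) (d : Finset (Fin h)) :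
    (∏ c ∈ d, zoTable σ a c) = if d ⊆ σ a then 1 else 0 := by
  unfold zoTable
  rw [Finset.prod_boole]
  rfl

/-- **Pair entry of the 0/1 segment-moment matrix.**  For `a ≠ b`:
`segEntry (zoTable σ) {a,b} T = [T ⊆ σ a ∪ σ b] · betaSum |T ∖ σ b| |T ∖ σ a| |T ∩ σ a ∩ σ b|`. -/
theorem segSum_pair_zoTable (σ : Fin h → Finset (Fin h)) (a b : Fin h) (hab : a ≠ b)
    (T : Finset (Fin h)) :
    (∑ g : (↥T → ↥({a, b} : Finset (Fin h))), (∏ c : ↥T, zoTable σ (g c) c) *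
        ∏ a' : ↥({a, b} : Finset (Fin h)),
          ((Finset.univ.filter fun c : ↥T => g c = a').card.factorial : ℂ)) =
      if T ⊆ σ a ∪ σ b then
        (betaSum (T \ σ b).card (T \ σ a).card (T ∩ σ a ∩ σ b).card : ℂ) else 0 := by
  classical
  rw [segSum_pair (zoTable σ) a b hab T]
  simp_rw [prod_zoTable]
  -- the summand is `|d|! |T∖d|!` if `d ⊆ σ a` and `T ∖ d ⊆ σ b`, else `0`
  have hsum : (∑ d ∈ T.powerset, (d.card.factorial : ℂ) * ((T \ d).card.factorial : ℂ) *
        ((if d ⊆ σ a then (1 : ℂ) else 0) * (if T \ d ⊆ σ b then (1 : ℂ) else 0))) =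
      ∑ d ∈ T.powerset.filter (fun d => d ⊆ σ a ∧ T \ d ⊆ σ b),
        (d.card.factorial : ℂ) * ((T \ d).card.factorial : ℂ) := by
    rw [Finset.sum_filter]
    refine Finset.sum_congr rfl fun d _ => ?_
    by_cases h1 : d ⊆ σ a <;> by_cases h2 : T \ d ⊆ σ b <;> simp [h1, h2]
  rw [hsum]
  by_cases hT : T ⊆ σ a ∪ σ b
  · rw [if_pos hT]
    -- re-index by `E = d ∩ σ b ⊆ C := T ∩ σ a ∩ σ b`, `d = (T ∖ σ b) ∪ E`
    set A := T \ σ b with hA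
    set C := T ∩ σ a ∩ σ b with hC
    have hAC : Disjoint A C := by
      rw [Finset.disjoint_left]
      intro c hcA hcC
      rw [hA, Finset.mem_sdiff] at hcA
      rw [hC, Finset.mem_inter] at hcC
      exact hcA.2 hcC.2
    have hAa : A ⊆ σ a := by
      intro c hc
      rw [hA, Finset.mem_sdiff] at hc
      rcases Finset.mem_union.mp (hT hc.1) with h1 | h2
      · exact h1
      · exact absurd h2 hc.2
    -- the bijection
    have step : (∑ d ∈ T.powerset.filter (fun d => d ⊆ σ a ∧ T \ d ⊆ σ b),
        (d.card.factorial : ℂ) * ((T \ d).card.factorial : ℂ)) =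
        ∑ E ∈ C.powerset, (((A.card + E.card).factorial : ℕ) : ℂ) *
          ((((T \ σ a).card + (C.card - E.card)).factorial : ℕ) : ℂ) := by
      refine Finset.sum_nbij' (fun d => d ∩ σ b) (fun E => A ∪ E) ?_ ?_ ?_ ?_ ?_
      · intro d hd
        rw [Finset.mem_filter, Finset.mem_powerset] at hd
        rw [Finset.mem_powerset]
        intro c hc
        rw [Finset.mem_inter] at hc
        rw [hC, Finset.mem_inter, Finset.mem_inter]
        exact ⟨⟨hd.1 hc.1, hd.2.1 hc.1⟩, hc.2⟩
      · intro E hE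
        rw [Finset.mem_powerset] at hE
        rw [Finset.mem_filter, Finset.mem_powerset]
        refine ⟨?_, ?_, ?_⟩
        · intro c hc
          rcases Finset.mem_union.mp hc with h1 | h2
          · rw [hA, Finset.mem_sdiff] at h1; exact h1.1
          · have := hE h2; rw [hC, Finset.mem_inter, Finset.mem_inter] at this; exact this.1.1
        · intro c hc
          rcases Finset.mem_union.mp hc with h1 | h2
          · exact hAa h1
          · have := hE h2; rw [hC, Finset.mem_inter, Finset.mem_inter] at this; exact this.1.2
        · intro c hc
          rw [Finset.mem_sdiff] at hc
          by_contra hcb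
          exact hc.2 (Finset.mem_union.mpr (Or.inl (by rw [hA, Finset.mem_sdiff]; exact ⟨hc.1, hcb⟩)))
      · -- left inverse: (d ∩ σ b) ↦ A ∪ (d ∩ σ b) = d
        intro d hd
        rw [Finset.mem_filter, Finset.mem_powerset] at hd
        ext c
        rw [Finset.mem_union, Finset.mem_inter, hA, Finset.mem_sdiff]
        constructor
        · rintro (⟨hcT, hcb⟩ | ⟨hcd, _⟩)
          · by_contra hcd
            exact hcb (hd.2.2 (Finset.mem_sdiff.mpr ⟨hcT, hcd⟩))
          · exact hcd
        · intro hcd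
          by_cases hcb : c ∈ σ b
          · exact Or.inr ⟨hcd, hcb⟩
          · exact Or.inl ⟨hd.1 hcd, hcb⟩
      · -- right inverse: E ↦ (A ∪ E) ∩ σ b = E
        intro E hE
        rw [Finset.mem_powerset] at hE
        ext c
        rw [Finset.mem_inter, Finset.mem_union, hA, Finset.mem_sdiff]
        constructor
        · rintro ⟨⟨_, hcb⟩ | hcE, hcb'⟩
          · exact absurd hcb' hcb
          · exact hcE
        · intro hcE
          have := hE hcE
          rw [hC, Finset.mem_inter, Finset.mem_inter] at this
          exact ⟨Or.inr hcE, this.2⟩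
      · -- the summand
        intro d hd
        rw [Finset.mem_filter, Finset.mem_powerset] at hd
        obtain ⟨hdT, hda, hdb⟩ := hd
        have hdsplit : d = A ∪ (d ∩ σ b) := by
          ext c
          rw [Finset.mem_union, Finset.mem_inter, hA, Finset.mem_sdiff]
          constructor
          · intro hcd
            by_cases hcb : c ∈ σ b
            · exact Or.inr ⟨hcd, hcb⟩
            · exact Or.inl ⟨hdT hcd, hcb⟩
          · rintro (⟨hcT, hcb⟩ | ⟨hcd, _⟩)
            · by_contra hcd
              exact hcb (hdb (Finset.mem_sdiff.mpr ⟨hcT, hcd⟩))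
            · exact hcd
        have hdisj : Disjoint A (d ∩ σ b) := by
          rw [Finset.disjoint_left]
          intro c hcA hcE
          rw [hA, Finset.mem_sdiff] at hcA
          exact hcA.2 (Finset.mem_inter.mp hcE).2
        have hcard1 : d.card = A.card + (d ∩ σ b).card := by
          conv_lhs => rw [hdsplit]
          exact Finset.card_union_of_disjoint hdisj
        -- `T ∖ d = (T ∖ σ a) ⊔ (C ∖ (d ∩ σ b))`
        have hEC : d ∩ σ b ⊆ C := by
          intro c hc
          rw [Finset.mem_inter] at hc
          rw [hC, Finset.mem_inter, Finset.mem_inter]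
          exact ⟨⟨hdT hc.1, hda hc.1⟩, hc.2⟩
        have hsdiff : T \ d = (T \ σ a) ∪ (C \ (d ∩ σ b)) := by
          ext c
          rw [Finset.mem_sdiff, Finset.mem_union, Finset.mem_sdiff, Finset.mem_sdiff, hC,
            Finset.mem_inter, Finset.mem_inter, Finset.mem_inter]
          constructor
          · rintro ⟨hcT, hcd⟩
            by_cases hca : c ∈ σ a
            · refine Or.inr ⟨⟨⟨hcT, hca⟩, hdb (Finset.mem_sdiff.mpr ⟨hcT, hcd⟩)⟩, ?_⟩
              rintro ⟨hcd', _⟩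
              exact hcd hcd'
            · exact Or.inl ⟨hcT, hca⟩
          · rintro (⟨hcT, hca⟩ | ⟨⟨⟨hcT, hca⟩, hcb⟩, hnot⟩)
            · exact ⟨hcT, fun hcd => hca (hda hcd)⟩
            · exact ⟨hcT, fun hcd => hnot ⟨hcd, hcb⟩⟩
        have hdisj2 : Disjoint (T \ σ a) (C \ (d ∩ σ b)) := by
          rw [Finset.disjoint_left]
          intro c hc1 hc2
          rw [Finset.mem_sdiff] at hc1
          rw [Finset.mem_sdiff, hC, Finset.mem_inter, Finset.mem_inter] at hc2
          exact hc1.2 hc2.1.1.2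
        have hcard2 : (T \ d).card = (T \ σ a).card + (C.card - (d ∩ σ b).card) := by
          rw [hsdiff, Finset.card_union_of_disjoint hdisj2, Finset.card_sdiff_of_subset hEC]
        rw [hcard1, hcard2]
    rw [step, Finset.sum_powerset_apply_card
      (fun n : ℕ => ((((A.card + n).factorial : ℕ) : ℂ) *
        ((((T \ σ a).card + (C.card - n)).factorial : ℕ) : ℂ)))]
    unfold betaSum
    push_cast
    exact Finset.sum_congr rfl fun i _ => by rw [nsmul_eq_mul]
  · rw [if_neg hT]
    refine Finset.sum_eq_zero fun d hd => ?_
    exfalso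
    rw [Finset.mem_filter, Finset.mem_powerset] at hd
    apply hT
    intro c hc
    by_cases hcd : c ∈ d
    · exact Finset.mem_union.mpr (Or.inl (hd.2.1 hcd))
    · exact Finset.mem_union.mpr (Or.inr (hd.2.2 (Finset.mem_sdiff.mpr ⟨hc, hcd⟩)))

/-- The three Venn counts add up to `|T|` when `T ⊆ σ a ∪ σ b`. -/
theorem card_venn (σ : Fin h → Finset (Fin h)) (a b : Fin h) (T : Finset (Fin h))
    (hT : T ⊆ σ a ∪ σ b) :
    (T \ σ b).card + (T \ σ a).card + (T ∩ σ a ∩ σ b).card = T.card := by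
  classical
  have e : T = ((T \ σ b) ∪ (T \ σ a)) ∪ (T ∩ σ a ∩ σ b) := by
    ext c
    simp only [Finset.mem_union, Finset.mem_sdiff, Finset.mem_inter]
    constructor
    · intro hc
      by_cases hca : c ∈ σ a <;> by_cases hcb : c ∈ σ b
      · exact Or.inr ⟨⟨hc, hca⟩, hcb⟩
      · exact Or.inl (Or.inl ⟨hc, hcb⟩)
      · exact Or.inl (Or.inr ⟨hc, hca⟩)
      · exact absurd (hT hc) (by rw [Finset.mem_union]; exact fun h' => h'.elim hca hcb)
    · rintro ((⟨hc, _⟩ | ⟨hc, _⟩) | ⟨⟨hc, _⟩, _⟩) <;> exact hc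
  have d1 : Disjoint (T \ σ b) (T \ σ a) := by
    rw [Finset.disjoint_left]
    intro c h1 h2
    rw [Finset.mem_sdiff] at h1 h2
    rcases Finset.mem_union.mp (hT h1.1) with hca | hcb
    · exact h2.2 hca
    · exact h1.2 hcb
  have d2 : Disjoint ((T \ σ b) ∪ (T \ σ a)) (T ∩ σ a ∩ σ b) := by
    rw [Finset.disjoint_left]
    intro c h1 h2
    rw [Finset.mem_inter, Finset.mem_inter] at h2
    rcases Finset.mem_union.mp h1 with h3 | h3 <;> rw [Finset.mem_sdiff] at h3
    · exact h3.2 h2.2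
    · exact h3.2 h2.1.2
  conv_rhs => rw [e]
  rw [Finset.card_union_of_disjoint d2, Finset.card_union_of_disjoint d1]

/-- **E-normal form of the pair entry**: multiplying by `(p+q+1)!` turns the 0/1 pair entry into
`[T ⊆ σ a ∪ σ b] · p! · q! · (|T|+1)!`; i.e. after dividing column `T` by `(|T|+1)!` the entry is the
Beta integral `p! q!/(p+q+1)! = ∫₀¹ t^p (1-t)^q dt`, the mean of `z^T` over the segment `[𝟙_{σ a}, 𝟙_{σ b}]`. -/
theorem segSum_pair_zoTable_mul (σ : Fin h → Finset (Fin h)) (a b : Fin h) (hab : a ≠ b)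
    (T : Finset (Fin h)) :
    (∑ g : (↥T → ↥({a, b} : Finset (Fin h))), (∏ c : ↥T, zoTable σ (g c) c) *
        ∏ a' : ↥({a, b} : Finset (Fin h)),
          ((Finset.univ.filter fun c : ↥T => g c = a').card.factorial : ℂ)) *
      ((((T \ σ b).card + (T \ σ a).card + 1).factorial : ℕ) : ℂ) =
      if T ⊆ σ a ∪ σ b then
        ((((T \ σ b).card.factorial * (T \ σ a).card.factorial * (T.card + 1).factorial : ℕ)) : ℂ)
      else 0 := by
  rw [segSum_pair_zoTable σ a b hab T]
  by_cases hT : T ⊆ σ a ∪ σ b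
  · rw [if_pos hT, if_pos hT, ← card_venn σ a b T hT]
    have := betaSum_mul_factorial (T \ σ b).card (T \ σ a).card (T ∩ σ a ∩ σ b).card
    exact_mod_cast this
  · rw [if_neg hT, if_neg hT, zero_mul]

/-! ## 3. CONJECTURE Z01 (typed node) and its transfer to the line's `stub_segmentMeanValue` -/

/-- **CONJECTURE Z01 — 0/1 segment designs exist at every height** (val-np-p4 g19, 2026-08-28): for every `h`
there is a family of supports `σ : Fin h → Finset (Fin h)` whose 0/1 table `zoTable σ` makes the segment-moment
matrix of the benchmark layout nonsingular (for every enumeration `u` of the rows — re-enumeration only changes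
the sign).  By `segSum_pair_zoTable_mul` the matrix is, up to the column units `(|T|+1)!`, the rational matrix
`[T ⊆ σ a ∪ σ b] · p! q!/(p+q+1)!` (`p = |T ∖ σ b|`, `q = |T ∖ σ a|`; rows `{a}`: `[T ⊆ σ a]/(|T|+1)`; row `∅`:
`[T = ∅]`).  Evidence: exhaustive h = 4, 5; random / hill-climbing h ≤ 32 (kit j306146).  WHY IT MIGHT FAIL: a
height at which every 0/1 family is singular (a global 2-adic obstruction of the threshold complex `W_h`; none up
to 32); the S10 supports alone (all scalars 1) are singular from h = 5 on, so the choice of supports is the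
whole content. -/
def Stmt.stub_zeroOneDesign : Prop :=
  ∀ h : ℕ, ∃ σ : Fin h → Finset (Fin h),
    ∀ (r : ℕ) (u : Fin r → Finset (Fin h)), Function.Injective u → (∀ i, (u i).card ≤ 2) →
      (∀ S : Finset (Fin h), S.card ≤ 2 → ∃ i, u i = S) →
      (Matrix.of fun i j : Fin r =>
        ∑ g : (↥(benchCols h r j) → ↥(u i)), (∏ c : ↥(benchCols h r j), zoTable σ (g c) c) *
          ∏ a : ↥(u i),
            ((Finset.univ.filter fun c : ↥(benchCols h r j) => g c = a).card.factorial : ℂ)).det ≠ 0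

/-- **Z01 ⟹ the line's `stub_segmentMeanValue`** (`∀ h, SegmentMeanValueAt h`, unfolded verbatim as in
`ChowBenchmarkDual.stub_dualisation`): ∃-introduction with the 0/1 table. -/
theorem segmentMeanValue_of_zeroOneDesign (H : Stmt.stub_zeroOneDesign) : ∀ h : ℕ,
    ∀ (r : ℕ) (u : Fin r → Finset (Fin h)), Function.Injective u → (∀ i, (u i).card ≤ 2) →
      (∀ S : Finset (Fin h), S.card ≤ 2 → ∃ i, u i = S) →
      ∃ P : Fin h → Fin h → ℂ,
        (Matrix.of fun i j : Fin r =>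
          ∑ g : (↥(benchCols h r j) → ↥(u i)), (∏ c : ↥(benchCols h r j), P (g c) c) *
            ∏ a : ↥(u i),
              ((Finset.univ.filter fun c : ↥(benchCols h r j) => g c = a).card.factorial : ℂ)).det ≠ 0 := by
  intro h r u hu hcard hsurj
  obtain ⟨σ, hσ⟩ := H h
  exact ⟨zoTable σ, hσ r u hu hcard hsurj⟩

/-- **Z01 ⟹ the free-node benchmark at every height** (compose with the landed `stub_dualisation`). -/
theorem chowBenchPairs_of_zeroOneDesign (H : Stmt.stub_zeroOneDesign) (h : ℕ) :
    ∀ (r : ℕ) (u : Fin r → Finset (Fin h)), Function.Injective u → (∀ i, (u i).card ≤ 2) →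
      (∀ S : Finset (Fin h), S.card ≤ 2 → ∃ i, u i = S) →
      ∃ B : Fin h → Fin h → ℂ,
        (Matrix.of fun i j : Fin r => MvPolynomial.coeff
          (∑ a ∈ u i, Finsupp.single (Fin.castAdd h a) 1 +
            ∑ c ∈ benchCols h r j, Finsupp.single (Fin.natAdd h c) 1)
          (∏ a : Fin h, (MvPolynomial.X (Fin.castAdd h a) + 1 +
            ∑ c : Fin h, MvPolynomial.C (B a c) * MvPolynomial.X (Fin.natAdd h c)))).det ≠ 0 :=
  ChowBenchmarkDual.stub_dualisation h (segmentMeanValue_of_zeroOneDesign H h)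

end Summit.ValiantsHypothesis.ValiantsHypothesis.Theorems.BarrierLever.ChowBenchmarkZeroOne
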